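import Mathlib
import Summits.Ventures.PercRepro2.CoinChainXACross

/-!
# The CLOSED GATE of (XA′) — the region sums of the chain laws (blind cell PercRepro2, night-2 g30)

Infrastructure for CoinChainXAClosedGate.lean: the pointwise Holley inequality of the KILLED law
`ν(c − d)` against the coin law `νd` (`closed_gate_pw`), the partition of `U.powerset` into the
entry-free ideal `I₀`, the coin-entered clusters missing `ent` and the sure-entered clusters
(`sum_three_regions`, `sum_entfree_split`), the values of `chainMix` on the regions, and the
thirteen moments of the four chain laws at the CLOSED gate `d' ≡ 0` in terms of the region sums
(`cg_a0` … `cg_g1`), plus the split of the coin-entered `c`-mass into its killed and surviving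
parts (`cg_split`, `cg_split'`).
-/

namespace Summit.Ventures.PercRepro2.Coin

open Classical

section ClosedGatePw

variable {V : Type*} [DecidableEq V] {R : Type*} [Field R] [LinearOrder R] [IsStrictOrderedRing R]

/-- The pointwise Holley inequality of the killed law against the coin law:
`(c s − d s)·d t ≤ (c (s ∩ t) − d (s ∩ t))·d (s ∪ t)` from `0 ≤ d ≤ c`, the cross inequality and the
ratio monotonicity `d(s ∩ t)·c(s) ≤ c(s ∩ t)·d(s)`. -/
theorem closed_gate_pw (c d : Finset V → R) (hc0 : ∀ W, 0 ≤ c W) (hd0 : ∀ W, 0 ≤ d W)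
    (hdc : ∀ W, d W ≤ c W) (hcd : ∀ s t, c s * d t ≤ c (s ∩ t) * d (s ∪ t))
    (hratio : ∀ s t, s ⊆ t → d s * c t ≤ c s * d t) (s t : Finset V) :
    (c s - d s) * d t ≤ (c (s ∩ t) - d (s ∩ t)) * d (s ∪ t) := by
  have hi := hcd s t
  have hr := hratio (s ∩ t) s Finset.inter_subset_left
  have hP : 0 ≤ c (s ∩ t) - d (s ∩ t) := by linarith [hdc (s ∩ t)]
  rcases (hc0 (s ∩ t)).lt_or_eq with hPpos | hP0
  · rcases (hc0 t).lt_or_eq with hCpos | hC0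
    · -- multiply the target by `c (s ∩ t) * c t > 0`
      have hmul : c (s ∩ t) * c t * ((c s - d s) * d t) ≤
          c (s ∩ t) * c t * ((c (s ∩ t) - d (s ∩ t)) * d (s ∪ t)) := by
        have h1 : c (s ∩ t) * c t * ((c s - d s) * d t) ≤
            c t * d t * (c (s ∩ t) * c s - d (s ∩ t) * c s) := by
          have := mul_le_mul_of_nonneg_left hr (mul_nonneg (hc0 t) (hd0 t))
          linear_combination this
        have h2 : c t * d t * (c (s ∩ t) * c s - d (s ∩ t) * c s) ≤
            (c (s ∩ t) - d (s ∩ t)) * c t * (c (s ∩ t) * d (s ∪ t)) := by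
          have := mul_le_mul_of_nonneg_left hi (mul_nonneg hP (hc0 t))
          linear_combination this
        linear_combination h1 + h2
      exact le_of_mul_le_mul_left hmul (mul_pos hPpos hCpos)
    · -- `c t = 0`, hence `d t = 0`
      have hdt : d t = 0 := le_antisymm (by linarith [hdc t]) (hd0 t)
      rw [hdt, mul_zero]
      exact mul_nonneg hP (hd0 _)
  · -- `c (s ∩ t) = 0`, hence `d (s ∩ t) = 0` and `c s * d t = 0`
    have hdP : d (s ∩ t) = 0 := le_antisymm (by linarith [hdc (s ∩ t)]) (hd0 _)
    have hcsdt : c s * d t ≤ 0 := by rw [← hP0] at hi; linarith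
    rw [← hP0, hdP, sub_zero, zero_mul]
    nlinarith [mul_nonneg (hd0 s) (hd0 t)]

end ClosedGatePw

section ClosedGateSums

variable {V : Type*} [DecidableEq V] {R : Type*} [Field R]

/-- The three regions: the entry-free ideal, the coin-entered clusters missing `ent`, and the
sure-entered clusters. -/
theorem sum_three_regions (U ent ent' : Finset V) (f : Finset V → R) :
    ∑ W ∈ U.powerset, f W =
      (∑ W ∈ U.powerset.filter (fun W => ¬ ∃ r ∈ ent ∪ ent', r ∈ W), f W)
      + (∑ W ∈ U.powerset.filter (fun W => (¬ ∃ r ∈ ent, r ∈ W) ∧ ∃ r ∈ ent', r ∈ W), f W)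
      + (∑ W ∈ U.powerset.filter (fun W => ∃ r ∈ ent, r ∈ W), f W) := by
  simp only [Finset.sum_filter]
  rw [← Finset.sum_add_distrib, ← Finset.sum_add_distrib]
  refine Finset.sum_congr rfl (fun W _ => ?_)
  by_cases h0 : ∃ r ∈ ent, r ∈ W
  · have h01 : ∃ r ∈ ent ∪ ent', r ∈ W := by
      obtain ⟨r, hr, hrW⟩ := h0; exact ⟨r, Finset.mem_union.2 (Or.inl hr), hrW⟩
    rw [if_neg (not_not.2 h01), if_neg (fun h => h.1 h0), if_pos h0]; ring
  · by_cases h1 : ∃ r ∈ ent', r ∈ W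
    · have h01 : ∃ r ∈ ent ∪ ent', r ∈ W := by
        obtain ⟨r, hr, hrW⟩ := h1; exact ⟨r, Finset.mem_union.2 (Or.inr hr), hrW⟩
      rw [if_neg (not_not.2 h01), if_pos ⟨h0, h1⟩, if_neg h0]; ring
    · have h01 : ¬ ∃ r ∈ ent ∪ ent', r ∈ W := by
        rintro ⟨r, hr, hrW⟩
        rcases Finset.mem_union.1 hr with hr | hr
        · exact h0 ⟨r, hr, hrW⟩
        · exact h1 ⟨r, hr, hrW⟩
      rw [if_pos h01, if_neg (fun h => h1 h.2), if_neg h0]; ring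

/-- The `ent`-free clusters split into the ideal and the coin-entered ones. -/
theorem sum_entfree_split (U ent ent' : Finset V) (f : Finset V → R) :
    ∑ W ∈ U.powerset.filter (fun W => ¬ ∃ r ∈ ent, r ∈ W), f W =
      (∑ W ∈ U.powerset.filter (fun W => ¬ ∃ r ∈ ent ∪ ent', r ∈ W), f W)
      + (∑ W ∈ U.powerset.filter (fun W => (¬ ∃ r ∈ ent, r ∈ W) ∧ ∃ r ∈ ent', r ∈ W), f W) := by
  simp only [Finset.sum_filter]
  rw [← Finset.sum_add_distrib]
  refine Finset.sum_congr rfl (fun W _ => ?_)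
  by_cases h0 : ∃ r ∈ ent, r ∈ W
  · have h01 : ∃ r ∈ ent ∪ ent', r ∈ W := by
      obtain ⟨r, hr, hrW⟩ := h0; exact ⟨r, Finset.mem_union.2 (Or.inl hr), hrW⟩
    rw [if_neg (not_not.2 h0), if_neg (not_not.2 h01), if_neg (fun h => h.1 h0)]; ring
  · by_cases h1 : ∃ r ∈ ent', r ∈ W
    · have h01 : ∃ r ∈ ent ∪ ent', r ∈ W := by
        obtain ⟨r, hr, hrW⟩ := h1; exact ⟨r, Finset.mem_union.2 (Or.inr hr), hrW⟩
      rw [if_pos h0, if_neg (not_not.2 h01), if_pos ⟨h0, h1⟩]; ring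
    · have h01 : ¬ ∃ r ∈ ent ∪ ent', r ∈ W := by
        rintro ⟨r, hr, hrW⟩
        rcases Finset.mem_union.1 hr with hr | hr
        · exact h0 ⟨r, hr, hrW⟩
        · exact h1 ⟨r, hr, hrW⟩
      rw [if_pos h0, if_pos h01, if_neg (fun h => h1 h.2)]; ring

/-- The coin-closed law off the sure-entered clusters is `c`. -/
lemma cgate_mix0_c (ent ent' : Finset V) (c d : Finset V → R) {W : Finset V}
    (h : ¬ ∃ r ∈ ent, r ∈ W) : chainMix ent ent' 0 c d W = c W := by
  unfold chainMix chainTheta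
  by_cases h1 : ∃ r ∈ ent', r ∈ W <;> simp [h, h1]

/-- The coin-closed law on the sure-entered clusters is `d`. -/
lemma cgate_mix0_d (ent ent' : Finset V) (c d : Finset V → R) {W : Finset V}
    (h : ∃ r ∈ ent, r ∈ W) : chainMix ent ent' 0 c d W = d W := by
  unfold chainMix chainTheta
  simp [h]

/-- The coin-open law on the entry-free ideal is `c`. -/
lemma cgate_mix1_c (ent ent' : Finset V) (c d : Finset V → R) {W : Finset V}
    (h : ¬ ∃ r ∈ ent ∪ ent', r ∈ W) : chainMix ent ent' 1 c d W = c W := by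
  have h0 : ¬ ∃ r ∈ ent, r ∈ W := fun ⟨r, hr, hrW⟩ => h ⟨r, Finset.mem_union.2 (Or.inl hr), hrW⟩
  have h1 : ¬ ∃ r ∈ ent', r ∈ W := fun ⟨r, hr, hrW⟩ => h ⟨r, Finset.mem_union.2 (Or.inr hr), hrW⟩
  unfold chainMix chainTheta
  simp [h0, h1]

/-- The coin-open law on the entered clusters is `d`. -/
lemma cgate_mix1_d (ent ent' : Finset V) (c d : Finset V → R) {W : Finset V}
    (h : ∃ r ∈ ent ∪ ent', r ∈ W) : chainMix ent ent' 1 c d W = d W := by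
  unfold chainMix chainTheta
  obtain ⟨r, hr, hrW⟩ := h
  rcases Finset.mem_union.1 hr with hr | hr
  · have h0 : ∃ r ∈ ent, r ∈ W := ⟨r, hr, hrW⟩
    simp [h0]
  · have h1 : ∃ r ∈ ent', r ∈ W := ⟨r, hr, hrW⟩
    by_cases h0 : ∃ r ∈ ent, r ∈ W <;> simp [h0, h1]

/-- A cluster meeting `ent` meets `ent ∪ ent'`. -/
lemma cgate_meet_of_ent {ent ent' W : Finset V} (h : ∃ r ∈ ent, r ∈ W) :
    ∃ r ∈ ent ∪ ent', r ∈ W := by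
  obtain ⟨r, hr, hrW⟩ := h; exact ⟨r, Finset.mem_union.2 (Or.inl hr), hrW⟩

/-- A cluster meeting `ent'` meets `ent ∪ ent'`. -/
lemma cgate_meet_of_ent' {ent ent' W : Finset V} (h : ∃ r ∈ ent', r ∈ W) :
    ∃ r ∈ ent ∪ ent', r ∈ W := by
  obtain ⟨r, hr, hrW⟩ := h; exact ⟨r, Finset.mem_union.2 (Or.inr hr), hrW⟩

/-- A cluster missing `ent ∪ ent'` misses `ent`. -/
lemma cgate_not_meet_ent {ent ent' W : Finset V} (h : ¬ ∃ r ∈ ent ∪ ent', r ∈ W) :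
    ¬ ∃ r ∈ ent, r ∈ W := fun h' => h (cgate_meet_of_ent h')

omit [DecidableEq V] in
/-- A filtered sum of a summand vanishing on the filter is zero. -/
lemma cgate_sum_zero (U : Finset V) (P : Finset V → Prop) [DecidablePred P] (f : Finset V → R)
    (h : ∀ W, P W → f W = 0) : ∑ W ∈ U.powerset.filter P, f W = 0 :=
  Finset.sum_eq_zero (fun W hW => h W (Finset.mem_filter.1 hW).2)

variable (U ent ent' : Finset V) (ν c d : Finset V → R)

/-- `a0 = a + (δ + u) + t`: the coin-closed mass. -/
theorem cg_a0 :
    ∑ W ∈ U.powerset, ν W * chainMix ent ent' 0 c d W =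
      (∑ W ∈ U.powerset.filter (fun W => ¬ ∃ r ∈ ent ∪ ent', r ∈ W), ν W * c W)
      + (∑ W ∈ U.powerset.filter (fun W => (¬ ∃ r ∈ ent, r ∈ W) ∧ ∃ r ∈ ent', r ∈ W), ν W * c W)
      + (∑ W ∈ U.powerset.filter (fun W => ∃ r ∈ ent, r ∈ W), ν W * d W) := by
  rw [sum_three_regions U ent ent']
  congr 1
  congr 1
  · exact Finset.sum_congr rfl (fun W hW => by
      rw [cgate_mix0_c ent ent' c d (cgate_not_meet_ent (Finset.mem_filter.1 hW).2)])
  · exact Finset.sum_congr rfl (fun W hW => by rw [cgate_mix0_c ent ent' c d (Finset.mem_filter.1 hW).2.1])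
  · exact Finset.sum_congr rfl (fun W hW => by rw [cgate_mix0_d ent ent' c d (Finset.mem_filter.1 hW).2])

/-- `a1 = (XJ + XU) + XM` for a marker vanishing on the ideal. -/
theorem cg_a1 (x : Finset V → R) (hxI : ∀ W, (¬ ∃ r ∈ ent ∪ ent', r ∈ W) → x W = 0) :
    ∑ W ∈ U.powerset, ν W * chainMix ent ent' 0 c d W * x W =
      (∑ W ∈ U.powerset.filter (fun W => (¬ ∃ r ∈ ent, r ∈ W) ∧ ∃ r ∈ ent', r ∈ W), ν W * c W * x W)
      + (∑ W ∈ U.powerset.filter (fun W => ∃ r ∈ ent, r ∈ W), ν W * d W * x W) := by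
  rw [sum_three_regions U ent ent']
  have h1 : ∑ W ∈ U.powerset.filter (fun W => ¬ ∃ r ∈ ent ∪ ent', r ∈ W),
      ν W * chainMix ent ent' 0 c d W * x W = 0 :=
    cgate_sum_zero U _ _ (fun W hW => by rw [hxI W hW, mul_zero])
  rw [h1, zero_add]
  congr 1
  · exact Finset.sum_congr rfl (fun W hW => by rw [cgate_mix0_c ent ent' c d (Finset.mem_filter.1 hW).2.1])
  · exact Finset.sum_congr rfl (fun W hW => by rw [cgate_mix0_d ent ent' c d (Finset.mem_filter.1 hW).2])

/-- `b0 = a + u + t`: the coin-open mass. -/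
theorem cg_b0 :
    ∑ W ∈ U.powerset, ν W * chainMix ent ent' 1 c d W =
      (∑ W ∈ U.powerset.filter (fun W => ¬ ∃ r ∈ ent ∪ ent', r ∈ W), ν W * c W)
      + (∑ W ∈ U.powerset.filter (fun W => (¬ ∃ r ∈ ent, r ∈ W) ∧ ∃ r ∈ ent', r ∈ W), ν W * d W)
      + (∑ W ∈ U.powerset.filter (fun W => ∃ r ∈ ent, r ∈ W), ν W * d W) := by
  rw [sum_three_regions U ent ent']
  congr 1
  congr 1
  · exact Finset.sum_congr rfl (fun W hW => by rw [cgate_mix1_c ent ent' c d (Finset.mem_filter.1 hW).2])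
  · exact Finset.sum_congr rfl (fun W hW => by
      rw [cgate_mix1_d ent ent' c d (cgate_meet_of_ent' (Finset.mem_filter.1 hW).2.2)])
  · exact Finset.sum_congr rfl (fun W hW => by
      rw [cgate_mix1_d ent ent' c d (cgate_meet_of_ent (Finset.mem_filter.1 hW).2)])

/-- `b1 = XU + XM`. -/
theorem cg_b1 (x : Finset V → R) (hxI : ∀ W, (¬ ∃ r ∈ ent ∪ ent', r ∈ W) → x W = 0) :
    ∑ W ∈ U.powerset, ν W * chainMix ent ent' 1 c d W * x W =
      (∑ W ∈ U.powerset.filter (fun W => (¬ ∃ r ∈ ent, r ∈ W) ∧ ∃ r ∈ ent', r ∈ W), ν W * d W * x W)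
      + (∑ W ∈ U.powerset.filter (fun W => ∃ r ∈ ent, r ∈ W), ν W * d W * x W) := by
  rw [sum_three_regions U ent ent']
  have h1 : ∑ W ∈ U.powerset.filter (fun W => ¬ ∃ r ∈ ent ∪ ent', r ∈ W),
      ν W * chainMix ent ent' 1 c d W * x W = 0 :=
    cgate_sum_zero U _ _ (fun W hW => by rw [hxI W hW, mul_zero])
  rw [h1, zero_add]
  congr 1
  · exact Finset.sum_congr rfl (fun W hW => by
      rw [cgate_mix1_d ent ent' c d (cgate_meet_of_ent' (Finset.mem_filter.1 hW).2.2)])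
  · exact Finset.sum_congr rfl (fun W hW => by
      rw [cgate_mix1_d ent ent' c d (cgate_meet_of_ent (Finset.mem_filter.1 hW).2)])

/-- `e0 = a + (δ + u)`: the closed world-0 gate mass. -/
theorem cg_e0 :
    ∑ W ∈ U.powerset, ν W * chainMix ent ent' 0 c (fun _ => (0 : R)) W =
      (∑ W ∈ U.powerset.filter (fun W => ¬ ∃ r ∈ ent ∪ ent', r ∈ W), ν W * c W)
      + (∑ W ∈ U.powerset.filter (fun W => (¬ ∃ r ∈ ent, r ∈ W) ∧ ∃ r ∈ ent', r ∈ W), ν W * c W) := by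
  rw [sum_three_regions U ent ent']
  have h3 : ∑ W ∈ U.powerset.filter (fun W => ∃ r ∈ ent, r ∈ W),
      ν W * chainMix ent ent' 0 c (fun _ => (0 : R)) W = 0 :=
    cgate_sum_zero U _ _ (fun W hW => by rw [cgate_mix0_d ent ent' c _ hW, mul_zero])
  rw [h3, add_zero]
  congr 1
  · exact Finset.sum_congr rfl (fun W hW => by
      rw [cgate_mix0_c ent ent' c _ (cgate_not_meet_ent (Finset.mem_filter.1 hW).2)])
  · exact Finset.sum_congr rfl (fun W hW => by rw [cgate_mix0_c ent ent' c _ (Finset.mem_filter.1 hW).2.1])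

/-- `e1 = XJ + XU`. -/
theorem cg_e1 (x : Finset V → R) (hxI : ∀ W, (¬ ∃ r ∈ ent ∪ ent', r ∈ W) → x W = 0) :
    ∑ W ∈ U.powerset, ν W * chainMix ent ent' 0 c (fun _ => (0 : R)) W * x W =
      ∑ W ∈ U.powerset.filter (fun W => (¬ ∃ r ∈ ent, r ∈ W) ∧ ∃ r ∈ ent', r ∈ W), ν W * c W * x W := by
  rw [sum_three_regions U ent ent']
  have h1 : ∑ W ∈ U.powerset.filter (fun W => ¬ ∃ r ∈ ent ∪ ent', r ∈ W),
      ν W * chainMix ent ent' 0 c (fun _ => (0 : R)) W * x W = 0 :=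
    cgate_sum_zero U _ _ (fun W hW => by rw [hxI W hW, mul_zero])
  have h3 : ∑ W ∈ U.powerset.filter (fun W => ∃ r ∈ ent, r ∈ W),
      ν W * chainMix ent ent' 0 c (fun _ => (0 : R)) W * x W = 0 :=
    cgate_sum_zero U _ _ (fun W hW => by rw [cgate_mix0_d ent ent' c _ hW, mul_zero, zero_mul])
  rw [h1, h3, zero_add, add_zero]
  exact Finset.sum_congr rfl (fun W hW => by rw [cgate_mix0_c ent ent' c _ (Finset.mem_filter.1 hW).2.1])

/-- `g0 = a`: the closed world-1 gate mass is the ideal mass. -/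
theorem cg_g0 :
    ∑ W ∈ U.powerset, ν W * chainMix ent ent' 1 c (fun _ => (0 : R)) W =
      ∑ W ∈ U.powerset.filter (fun W => ¬ ∃ r ∈ ent ∪ ent', r ∈ W), ν W * c W := by
  rw [sum_three_regions U ent ent']
  have h2 : ∑ W ∈ U.powerset.filter (fun W => (¬ ∃ r ∈ ent, r ∈ W) ∧ ∃ r ∈ ent', r ∈ W),
      ν W * chainMix ent ent' 1 c (fun _ => (0 : R)) W = 0 :=
    cgate_sum_zero U _ _ (fun W hW => by
      rw [cgate_mix1_d ent ent' c _ (cgate_meet_of_ent' hW.2), mul_zero])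
  have h3 : ∑ W ∈ U.powerset.filter (fun W => ∃ r ∈ ent, r ∈ W),
      ν W * chainMix ent ent' 1 c (fun _ => (0 : R)) W = 0 :=
    cgate_sum_zero U _ _ (fun W hW => by rw [cgate_mix1_d ent ent' c _ (cgate_meet_of_ent hW), mul_zero])
  rw [h2, h3, add_zero, add_zero]
  exact Finset.sum_congr rfl (fun W hW => by rw [cgate_mix1_c ent ent' c _ (Finset.mem_filter.1 hW).2])

/-- `g1 = 0` (and `g2`, `g12`): the closed world-1 gate carries no marker mass. -/
theorem cg_g1 (z : Finset V → R) (hzI : ∀ W, (¬ ∃ r ∈ ent ∪ ent', r ∈ W) → z W = 0) :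
    ∑ W ∈ U.powerset, ν W * chainMix ent ent' 1 c (fun _ => (0 : R)) W * z W = 0 := by
  refine Finset.sum_eq_zero (fun W _ => ?_)
  by_cases h : ∃ r ∈ ent ∪ ent', r ∈ W
  · rw [cgate_mix1_d ent ent' c _ h]; simp
  · rw [hzI W h, mul_zero]

omit [DecidableEq V] in
/-- The coin-entered `c`-mass splits into the killed and the surviving parts. -/
theorem cg_split (P : Finset V → Prop) [DecidablePred P] (z : Finset V → R) :
    ∑ W ∈ U.powerset.filter P, ν W * c W * z W =
      (∑ W ∈ U.powerset.filter P, ν W * (c W - d W) * z W)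
      + (∑ W ∈ U.powerset.filter P, ν W * d W * z W) := by
  rw [← Finset.sum_add_distrib]
  exact Finset.sum_congr rfl (fun W _ => by ring)

omit [DecidableEq V] in
/-- The coin-entered `c`-mass splits into the killed and the surviving parts (masses). -/
theorem cg_split' (P : Finset V → Prop) [DecidablePred P] :
    ∑ W ∈ U.powerset.filter P, ν W * c W =
      (∑ W ∈ U.powerset.filter P, ν W * (c W - d W))
      + (∑ W ∈ U.powerset.filter P, ν W * d W) := by
  rw [← Finset.sum_add_distrib]
  exact Finset.sum_congr rfl (fun W _ => by ring)

end ClosedGateSums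

end Summit.Ventures.PercRepro2.Coin
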